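import Mathlib
import HarnessLib
import Literature.AlgebraicGeometry.Resolution.AlterationsDimension
import Literature.AlgebraicGeometry.Resolution.ComponentGluing
import Summits.ResolutionOfSingularities.ResolutionOfSingularities.Theorems.WildQuotientsWildQuotientResolutionS1aKillableReverse

/-!
# S1a — (A0) FOR MODELS OVER A FIELD: an aux move lowering `jInf` has SUPPORT CONTAINING EVERY TOP COMPONENT of the non-killable locus

[OURS · L1 W4.5c · lead-1 g8; plan-1 SIG KA v1 `AuxCentreContainsTop` (research, all data) — here PROVED datum-relative (models of finite type over a field),
as plan-1 anticipated (CHAIN v10.12 §0 (b))] — NOT statements of the manuscript; counted 0; AI-level work, weaker than expert review. Crux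
stmt-ResolutionOfSingularities-17941, line `s1a-logminvertex` v6.

* `AuxSupportTop.topologicalKrullDim_inter_open_eq` — in a scheme locally of finite type over a field, a non-empty open part of a closed irreducible subset
  has the same dimension (reduced induced subscheme `(vanishingIdeal C).subscheme`, integral; `topologicalKrullDim_opens_eq`, Görtz–Wedhorn 5.22 (3));
* ★★ `GameFrame.GModel.image_subset_support_of_jInf_lt` — models over a field: along an admissible move with `jInf Mʼ < jInf M`, every irreducible component
  of `nonKillable M` of dimension `jInf M` lies in the support of the centre (formal half = `topologicalKrullDim_nonKillable_diff_support_le_jInf`, p617035);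
* `AuxCentreContainsTopField p` (the datum-relative form of `AuxCentreContainsTop`) and ★ `auxCentreContainsTopField : AuxCentreContainsTopField p`.
-/

set_option linter.dupNamespace false

noncomputable section

universe u

open CategoryTheory Limits AlgebraicGeometry TopologicalSpace Topology
open Literature.AlgebraicGeometry.Resolution Literature.AlgebraicGeometry.RelativeSpec
open Summit.ResolutionOfSingularities.ResolutionOfSingularities.Theorems.WildQuotientResolution.S1
open Summit.ResolutionOfSingularities.ResolutionOfSingularities.Theorems.WildQuotientResolution.S1.NodeAtlas

namespace Summit.ResolutionOfSingularities.ResolutionOfSingularities.Theorems.WildQuotientResolution.S1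

/-! ## Dimension of an open part of a closed irreducible subset -/

namespace AuxSupportTop

variable {k : Type u} [Field k] {X : Scheme.{u}}

/-- **A non-empty open part of a closed irreducible subset of a scheme locally of finite type over a field has the dimension of the subset**
(reduced induced closed subscheme — an integral scheme of finite type over the field — and Görtz–Wedhorn 5.22 (3)). [OURS · L1 W4.5c] -/
theorem topologicalKrullDim_inter_open_eq (f : X ⟶ Spec (.of k)) [LocallyOfFiniteType f] {C : Set X} (hC : IsClosed C) (hCirr : IsIrreducible C)
    (U : X.Opens) (hne : (C ∩ (U : Set X)).Nonempty) : topologicalKrullDim ↥(C ∩ (U : Set X)) = topologicalKrullDim ↥C := by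
  let Z : Closeds X := ⟨C, hC⟩
  let ι := (Scheme.IdealSheafData.vanishingIdeal Z).subschemeι
  haveI : IsIntegral (Scheme.IdealSheafData.vanishingIdeal Z).subscheme := ComponentGluing.isIntegral_subscheme_vanishingIdeal Z hCirr
  have hmem : ∀ s : (Scheme.IdealSheafData.vanishingIdeal Z).subscheme, ι.base s ∈ C := fun s =>
    ComponentGluing.mem_of_subscheme_vanishingIdeal Z s
  have hsurj : ∀ x ∈ C, ∃ s : (Scheme.IdealSheafData.vanishingIdeal Z).subscheme, ι.base s = x := fun x hx => by
    have : x ∈ Set.range ι := by rw [ComponentGluing.range_subschemeι_vanishingIdeal Z]; exact hx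
    exact this
  have hιemb : IsEmbedding ι.base := (ι.isClosedEmbedding).isEmbedding
  -- `S ≃ C`
  let g₀ : ↥(Scheme.IdealSheafData.vanishingIdeal Z).subscheme → ↥C := fun s => ⟨ι.base s, hmem s⟩
  have hg₀ : IsHomeomorph g₀ := by
    rw [isHomeomorph_iff_isEmbedding_surjective]
    refine ⟨(IsEmbedding.subtypeVal.of_comp_iff).mp hιemb, fun y => ?_⟩
    obtain ⟨s, hs⟩ := hsurj y.1 y.2
    exact ⟨s, Subtype.ext hs⟩
  have h1 := IsHomeomorph.topologicalKrullDim_eq g₀ hg₀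
  -- the open `ι⁻¹ U ≃ C ∩ U`
  let V : (Scheme.IdealSheafData.vanishingIdeal Z).subscheme.Opens := ι ⁻¹ᵁ U
  have hVne : (V : Set (Scheme.IdealSheafData.vanishingIdeal Z).subscheme).Nonempty := by
    obtain ⟨x, hxC, hxU⟩ := hne
    obtain ⟨s, hs⟩ := hsurj x hxC
    exact ⟨s, show ι.base s ∈ (U : Set X) from hs ▸ hxU⟩
  have h2 := topologicalKrullDim_opens_eq (ι ≫ f) V hVne
  let g : ↥V → ↥(C ∩ (U : Set X)) := fun s => ⟨ι.base s.1, hmem s.1, s.2⟩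
  have hg : IsHomeomorph g := by
    rw [isHomeomorph_iff_isEmbedding_surjective]
    refine ⟨(IsEmbedding.subtypeVal.of_comp_iff).mp (hιemb.comp IsEmbedding.subtypeVal), fun y => ?_⟩
    obtain ⟨s, hs⟩ := hsurj y.1 y.2.1
    exact ⟨⟨s, show ι.base s ∈ (U : Set X) from hs ▸ y.2.2⟩, Subtype.ext hs⟩
  rw [← h1, ← h2]
  exact (IsHomeomorph.topologicalKrullDim_eq g hg).symm

end AuxSupportTop

/-! ## (A0) for models over a field -/

namespace GameFrame.GModel

open AuxSupportTop

variable {p : ℕ} {X' X₁ : Scheme.{0}} {q : X' ⟶ X₁} {G : Type} [Group G] {ρ : G →* Aut X'} {g₀ : G}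

/-- A model of a datum of finite type over a field is locally of finite type over the field. -/
theorem locallyOfFiniteType_of_datum {k : Type} [Field k] (f : X₁ ⟶ Spec (.of k)) [LocallyOfFiniteType f] [IsFinite q] (M : GModel p q G ρ g₀) :
    LocallyOfFiniteType (M.r ≫ f) := by
  haveI := M.isProper
  have hr : M.r = M.π ≫ q := M.r_eq
  rw [hr]
  infer_instance

/-- ★★ **(A0) FOR MODELS OVER A FIELD**: along an ADMISSIBLE move `M → Mʼ` (centre `(𝒦, d)`, `G`-stable piece `𝒦_d`) with `jInf Mʼ < jInf M`, every
irreducible component of `nonKillable M` of top dimension `jInf M` lies INSIDE the support of `𝒦_d`: off the support the non-killable locus embeds into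
`nonKillable Mʼ` (p617035), and a non-empty open part of a top component keeps the dimension `jInf M` (finite type over a field). [OURS · L1 W4.5c] -/
theorem image_subset_support_of_jInf_lt {k : Type} [Field k] (f : X₁ ⟶ Spec (.of k)) [LocallyOfFiniteType f] [IsFinite q] [Finite G]
    (hp : p.Prime) (hG : ∀ g : G, g ∈ Subgroup.zpowers g₀) (M M' : GModel p q G ρ g₀) (𝒦 : ReesFiltration M.V) (d : ℕ)
    (h𝒦G : ∀ g : G, (𝒦.ideal d).comap (M.act.aut g).hom = 𝒦.ideal d) (hmv : M.IsMoveOf M' 𝒦 d) (hlt : M'.jInf < M.jInf)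
    {C : Set ↥M.nonKillable} (hC : C ∈ irreducibleComponents ↥M.nonKillable) (hdim : topologicalKrullDim ↥C = M.jInf) :
    Subtype.val '' C ⊆ ((𝒦.ideal d).support : Set M.V) := by
  haveI := locallyOfFiniteType_of_datum f M
  intro x hx
  by_contra hxs
  -- the image component `C₁ ⊆ M.V`: closed, irreducible, of dimension `jInf M`
  have hC₁cl : IsClosed (Subtype.val '' C) :=
    M.isClosed_nonKillable.isClosedEmbedding_subtypeVal.isClosedMap _ (isClosed_of_mem_irreducibleComponents C hC)
  have hC₁irr : IsIrreducible (Subtype.val '' C) := hC.1.image _ continuous_subtype_val.continuousOn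
  have hC₁dim : topologicalKrullDim ↥(Subtype.val '' C) = M.jInf := by
    rw [← hdim]
    refine (IsHomeomorph.topologicalKrullDim_eq (fun c : ↥C => (⟨c.1.1, c.1, c.2, rfl⟩ : ↥(Subtype.val '' C))) ?_).symm
    rw [isHomeomorph_iff_isEmbedding_surjective]
    refine ⟨(IsEmbedding.subtypeVal.of_comp_iff).mp
      (show IsEmbedding (fun c : ↥C => ((c : ↥M.nonKillable) : M.V)) from IsEmbedding.subtypeVal.comp IsEmbedding.subtypeVal), ?_⟩
    rintro ⟨_, c, hc, rfl⟩
    exact ⟨⟨c, hc⟩, rfl⟩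
  -- its open part off the support has the same dimension …
  let U : M.V.Opens := (𝒦.ideal d).support.compl
  have hne : (Subtype.val '' C ∩ (U : Set M.V)).Nonempty := ⟨x, hx, hxs⟩
  have h1 := topologicalKrullDim_inter_open_eq (M.r ≫ f) hC₁cl hC₁irr U hne
  -- … and lies in `nonKillable M ∖ supp`, whose dimension is at most `jInf Mʼ`
  have hsub : Subtype.val '' C ∩ (U : Set M.V) ⊆ M.nonKillable \ ((𝒦.ideal d).support : Set M.V) := by
    rintro y ⟨⟨c, _, rfl⟩, hyU⟩
    exact ⟨c.2, hyU⟩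
  have h2 : topologicalKrullDim ↥(Subtype.val '' C ∩ (U : Set M.V)) ≤ topologicalKrullDim ↥(M.nonKillable \ ((𝒦.ideal d).support : Set M.V)) :=
    (IsEmbedding.inclusion hsub).isInducing.topologicalKrullDim_le
  have h3 := M.topologicalKrullDim_nonKillable_diff_support_le_jInf hp hG M' (hasNoetherianBase_of_datum f M') 𝒦 d h𝒦G hmv
  rw [h1, hC₁dim] at h2
  exact absurd (lt_of_le_of_lt (h2.trans h3) hlt) (lt_irrefl _)

end GameFrame.GModel

/-- **`AuxCentreContainsTopField p`** — the DATUM-RELATIVE form of plan-1ʼs (A0) `AuxCentreContainsTop` (data over a field with `q` finite and `X₁` locally of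
finite type): if an admissible move strictly lowers `jInf`, the support of the centre contains every top-dimensional irreducible component of the
non-killable locus. [OURS · L1 W4.5c] -/
def AuxCentreContainsTopField (p : ℕ) : Prop :=
  ∀ (k : Type) [Field k] ⦃X' X₁ : Scheme.{0}⦄ (f : X₁ ⟶ Spec (.of k)) (q : X' ⟶ X₁) (G : Type) [Group G] [Finite G] (ρ : G →* Aut X') (g₀ : G),
    LocallyOfFiniteType f → IsFinite q → (∀ g : G, g ∈ Subgroup.zpowers g₀) →
    ∀ (M M' : GameFrame.GModel p q G ρ g₀) (𝒦 : ReesFiltration M.V) (d : ℕ),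
      IsAdmissibleCentre p M.act g₀ 𝒦 d → M.IsMoveOf M' 𝒦 d → M'.jInf < M.jInf →
      ∀ t ∈ irreducibleComponents ↥M.nonKillable, topologicalKrullDim ↥t = M.jInf →
        Subtype.val '' t ⊆ ((𝒦.ideal d).support : Set M.V)

/-- ★ **(A0) HOLDS over a field.** [OURS · L1 W4.5c] -/
theorem auxCentreContainsTopField {p : ℕ} (hp : p.Prime) : AuxCentreContainsTopField p := by
  intro k _ X' X₁ f q G _ _ ρ g₀ hft hfin hG M M' 𝒦 d hadm hmv hlt t ht hdim
  haveI := hft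
  haveI := hfin
  exact GameFrame.GModel.image_subset_support_of_jInf_lt f hp hG M M' 𝒦 d (fun g => hadm.2.1 g d) hmv hlt ht hdim

end Summit.ResolutionOfSingularities.ResolutionOfSingularities.Theorems.WildQuotientResolution.S1

end
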